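import Summits.NavierStokesRegularity.NavierStokesRegularity.Theorems.ScenarioCensusRowF1IntQuenchKill
import Summits.NavierStokesRegularity.NavierStokesRegularity.Theorems.ScenarioCensusRowF1IntStretchBudget
import HarnessLib

/-!
# LINE «integrated-quench» port, part 3/7: §4 (b) — the vorticity equation on the classical windows of `𝒦` (`vdot`), continuity of the slice data, the forward-shrinking
# cut-off `χ` (`Rad`, `aW`, `chi`)

Re-homed for the scenario census (typer seat ns-census-typer-1 g8; the cell F1iq and the floor DI are MEMBERS OF RECORD «DECIDED IN KERNEL IN FILES» of row F1 since
census v1.76 (critic idea-crit-3 g7 PASS — no price 01:59:11Z; ref ns-census-ref g9 PRE-CHECK ✓ §14.27 item 35; lead-presearch label); this port makes them TREE-decided):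
VERBATIM PORT of ns-idea-3 LINE 22 «integrated-quench», `pub/ideators/ns-idea-3/lines/integrated-quench/line-integrated-quench.lean` sha16 d7402efa28ebc137 (2066 l.,
lean check rc 0, 0 sorry), split for the 400-line rule into seven parts `ScenarioCensusRowF1IntQuench{∅, Kill, Cutoff, Enstrophy, Liouville, Transfer, Top}` (chain
imports).  Lean text VERBATIM in namespace `…Theorems.ScenarioCensus.IntegratedQuench` (the line's `…Cruxes.ScenarioCensusRowF1.IntegratedQuenchLine` re-homed); port
edits: the bracket lines `section IntegralTransfer` / `end IntegralTransfer` dropped (no `variable`s), `@[conjecture]` on the residual `IqSlack` (≡ `ScenarioCensus.Row_F1`,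
OPEN), forty-five one-line docstrings added (gate lint); lemmas the line shares VERBATIM with the landed inviscid-top / frozen-top / columnar-top / stretched-top /
integrated-stretch ports are taken BY NAME (listed below); `norm_laplacian_curl_le` (twin of the tree's `clockAP_norm_laplacian_curl_le`, whose module has no farm build) is
not re-declared and its single use carries the line's own proof as a local `have` (proof text only).  Statements untouched.

No census VALUE is moved here (row F1 stays OPEN-WITH-LINE; the members become TREE-decided by name); NS regularity is NOT proved; `Row_F1` is untouched
(zero movement, `iqSlack_iff_rowF1`); no summit statement is proved by this file. Lemmas that restate already-landed tree declarations are taken BY NAME (gate lint `dedup.landed`): `convect_curl_self` = `FrozenTop.convect_curl_self`, `fderiv_smul_stPull_apply` = `InviscidTop.fderiv_smul_stPull_apply`, `fderiv_smul_stPull` = `InviscidTop.fderiv_smul_stPull`, `fderiv_fderiv_smul_stPull` = `InviscidTop.fderiv_fderiv_smul_stPull`, `tendsto_clm_of_tendsto_apply` = `InviscidTop.tendsto_clm_of_tendsto_apply`, `tendsto_fderiv_fderiv_apply_of_bound` = `InviscidTop.tendsto_fderiv_fderiv_apply_of_bound`, `tendsto_fderiv_fderiv_of_bound` = `InviscidTop.tendsto_fderiv_fderiv_of_bound`,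 `tendsto_fderiv_fderiv_of_typeI_seq_Ioo` = `InviscidTop.tendsto_fderiv_fderiv_of_typeI_seq_Ioo`, `fderiv3_smul_stPull` = `FrozenTop.fderiv3_smul_stPull`, `tendsto_fderiv3_of_typeI_seq_Ioo` = `FrozenTop.tendsto_fderiv3_of_typeI_seq_Ioo`, `tendsto_physicalTime` = `ColumnarTop.tendsto_physicalTime`, `eventually_fast` = `ColumnarTop.eventually_fast`, `sqrt_timeLag` = `StretchedTop.sqrt_timeLag`, `forall_of_forall_ne_zero` = `StretchedTop.forall_of_forall_ne_zero`, `radius_eq` = `FrozenTop.radius_eq`, `jointCond_everywhere₆` = `FrozenTop.jointCond_everywhere₄`, `continuousOn_quad` = `IntegratedStretch.continuousOn_quad`, `sqrt_nu_timeLag` = `IntegratedStretch.sqrt_nu_timeLag`, `continuous_maxRdnu` = `IntegratedStretch.continuous_maxRdnu`, `sing_of_not_bounded` = `InviscidTop.sing_of_not_bounded`, `nonIntensifying_ancient_trivial` = `eq_zero_of_nonIntensifying`, `vort_eq` = `FrozenTop.freeze_eq`, `exists_singularZoom_package₃` = `FrozenTop.exists_singularZoom_package₃`, `lapD_eq_zero_of_eq_zero`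 = `FrozenTop.lapD_eq_zero_of_eq_zero`.
-/

-- the summit and its single problem share the name `NavierStokesRegularity` (D-0017 nested layout)
set_option linter.dupNamespace false

noncomputable section

open MeasureTheory Set Function Filter TopologicalSpace Metric
open scoped Topology NNReal ENNReal InnerProductSpace RealInnerProductSpace Laplacian

namespace Summit.NavierStokesRegularity.NavierStokesRegularity.Theorems.ScenarioCensus.IntegratedQuench

open Literature.Analysis Literature.Analysis.FluidPDE
open Summit.NavierStokesRegularity.NavierStokesRegularity.Theorems

/-! ## The vorticity equation on the classical windows of `𝒦`: time derivative of the vorticity -/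

/-- Triangle inequality for `a - b + c`. -/
theorem norm_sub_add_le (a b c : E3) : ‖a - b + c‖ ≤ ‖a‖ + ‖b‖ + ‖c‖ :=
  (norm_add_le _ _).trans (by linarith [norm_sub_le a b])

/-- The unit-viscosity vorticity-equation right-hand side `Δω − (W·∇)ω + (ω·∇)W` of the slice `W(σ)`. -/
def vdot (W : ℝ → E3 → E3) (σ : ℝ) (y : E3) : E3 :=
  (Δ (curl (W σ))) y - convect (W σ) (curl (W σ)) y + convect (curl (W σ)) (W σ) y

/-- **Time derivative of the vorticity in `𝒦`**: `∂_σ curl W(σ)(y) = Δω − (W·∇)ω + (ω·∇)W` (𝒦 is classical on every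
window `(t₀, 0)`, tree `exists_isClassicalNSSolutionOn_Ioo`; the vorticity equation, tree `vorticity_eq`). -/
theorem hasDerivAt_curl {C : ℝ} {W : ℝ → E3 → E3} (hW : IsTypeIAncientMild C W) {σ : ℝ} (hσ : σ < 0) (y : E3) :
    HasDerivAt (fun s => curl (W s) y) (vdot W σ y) σ := by
  have ht₀ : 2 * σ < 0 := by linarith
  obtain ⟨q, hcl⟩ := hW.exists_isClassicalNSSolutionOn_Ioo ht₀
  have hS : UniqueDiffOn ℝ (Ioo (2 * σ) 0) := uniqueDiffOn_Ioo _ _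
  have hScl : Ioo (2 * σ) 0 ⊆ closure (interior (Ioo (2 * σ) 0)) := by
    rw [interior_Ioo]; exact subset_closure
  have hsm : IsSmoothSpaceTimeOn (Ioo (2 * σ) 0) (vorticity W) :=
    hcl.smooth_velocity.isSmoothSpaceTimeOn_vorticity hS
  have hmem : σ ∈ Ioo (2 * σ) 0 := ⟨by linarith, hσ⟩
  have hv := hcl.vorticity_eq hS hScl (fun _ _ z => curl_zero z) hmem y
  rw [vorticity_apply, one_smul] at hv
  have e : timeDerivWithin (Ioo (2 * σ) 0) (vorticity W) σ y = vdot W σ y := by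
    rw [vdot, eq_sub_iff_add_eq.2 hv.symm]
    abel
  have hd := (hsm.hasDerivWithinAt_timeDerivWithin hS hmem y).hasDerivAt (Ioo_mem_nhds hmem.1 hmem.2)
  rw [e] at hd
  have hfun : (fun s => vorticity W s y) = fun s => curl (W s) y := funext fun s => by rw [vorticity_apply]
  rwa [hfun] at hd

/-- **All the pointwise bounds on a window** `(2t, t/2)`, uniformly over `𝒦_C`: the velocity, the vorticity, the
vorticity gradient and the vorticity-equation right-hand side are bounded by one constant. -/
theorem exists_bounds (C : ℝ) {t : ℝ} (ht : t < 0) :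
    ∃ B : ℝ, 0 ≤ B ∧ ∀ ⦃W : ℝ → E3 → E3⦄, IsTypeIAncientMild C W → ∀ σ ∈ Ioo (2 * t) (t / 2), ∀ y : E3,
      ‖W σ y‖ ≤ B ∧ ‖curl (W σ) y‖ ≤ B ∧ ‖fderiv ℝ (curl (W σ)) y‖ ≤ B ∧ ‖vdot W σ y‖ ≤ B := by
  obtain ⟨K₀, hK₀⟩ := exists_window_bound C 0 ht
  obtain ⟨K₁, hK₁⟩ := exists_window_bound C 1 ht
  obtain ⟨K₂, hK₂⟩ := exists_window_bound C 2 ht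
  obtain ⟨K₃, hK₃⟩ := exists_window_bound C 3 ht
  have hc0 : 0 ≤ ‖curlCLM‖ := ContinuousLinearMap.opNorm_nonneg _
  refine ⟨|K₀| + ‖curlCLM‖ * |K₁| + ‖curlCLM‖ * |K₂| +
    (3 * ‖curlCLM‖ * |K₃| + ‖curlCLM‖ * |K₂| * |K₀| + |K₁| * (‖curlCLM‖ * |K₁|)), by positivity,
    fun W hW σ hσ y => ?_⟩
  have hσ0 : σ < 0 := by linarith [hσ.2]
  have hv3 : ContDiff ℝ 3 (W σ) := (hW.contDiff_slice hσ0).of_le (by norm_cast)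
  have hv2 : ContDiff ℝ 2 (W σ) := hv3.of_le (by norm_cast)
  have h0 : ‖W σ y‖ ≤ |K₀| := by
    have := hK₀ hW σ hσ y; rw [norm_iteratedFDeriv_zero] at this; exact this.trans (le_abs_self _)
  have h1 : ‖fderiv ℝ (W σ) y‖ ≤ |K₁| := by
    have := hK₁ hW σ hσ y; rw [← norm_fderiv_eq_norm_iteratedFDeriv_one] at this
    exact this.trans (le_abs_self _)
  have h2 : ‖iteratedFDeriv ℝ 2 (W σ) y‖ ≤ |K₂| := (hK₂ hW σ hσ y).trans (le_abs_self _)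
  have h3 : ‖iteratedFDeriv ℝ 3 (W σ) y‖ ≤ |K₃| := (hK₃ hW σ hσ y).trans (le_abs_self _)
  have hω : ‖curl (W σ) y‖ ≤ ‖curlCLM‖ * |K₁| :=
    (norm_curl_le _ _).trans (mul_le_mul_of_nonneg_left h1 hc0)
  have hDω : ‖fderiv ℝ (curl (W σ)) y‖ ≤ ‖curlCLM‖ * |K₂| :=
    (norm_fderiv_curl_le hv2 y).trans (mul_le_mul_of_nonneg_left h2 hc0)
  have hΔ : ‖(Δ (curl (W σ))) y‖ ≤ 3 * ‖curlCLM‖ * |K₃| := by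
    -- the line's `norm_laplacian_curl_le` (twin of the tree's `clockAP_norm_laplacian_curl_le`, whose module has no farm build) inlined as a local lemma:
    have hlap : ∀ (v : E3 → E3), ContDiff ℝ 3 v → ∀ x : E3,
        ‖(Δ (curl v)) x‖ ≤ 3 * (‖curlCLM‖ * ‖iteratedFDeriv ℝ 3 v x‖) := by
      intro v hv x
      have hv3 : ContDiff ℝ (2 + 1) v := hv.of_le (le_of_eq (by norm_num))
      have hω2 : ContDiff ℝ 2 (curl v) := contDiff_curl hv3
      set b := EuclideanSpace.basisFun (Fin 3) ℝ with hb
      have hb1 : ∀ i, ‖b i‖ = 1 := fun i => b.orthonormal.1 i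
      rw [laplacian_eq_sum_fderiv_fderiv b hω2]
      have hi : ∀ i : Fin 3, ‖fderiv ℝ (fun y => fderiv ℝ (curl v) y (b i)) x (b i)‖ ≤
          ‖curlCLM‖ * ‖iteratedFDeriv ℝ 3 v x‖ := by
        intro i
        rw [fderiv_fderiv_apply_const hω2 x (b i)]
        calc ‖iteratedFDeriv ℝ 2 (curl v) x ![b i, b i]‖
            ≤ ‖iteratedFDeriv ℝ 2 (curl v) x‖ * ∏ j, ‖(![b i, b i] : Fin 2 → E3) j‖ :=
              ContinuousMultilinearMap.le_opNorm _ _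
          _ = ‖iteratedFDeriv ℝ 2 (curl v) x‖ := by simp [Fin.prod_univ_two, hb1]
          _ ≤ _ := norm_iteratedFDeriv_two_curl_le hv x
      calc ‖∑ i, fderiv ℝ (fun y => fderiv ℝ (curl v) y (b i)) x (b i)‖
          ≤ ∑ i, ‖fderiv ℝ (fun y => fderiv ℝ (curl v) y (b i)) x (b i)‖ := norm_sum_le _ _
        _ ≤ ∑ _i : Fin 3, ‖curlCLM‖ * ‖iteratedFDeriv ℝ 3 v x‖ :=
            Finset.sum_le_sum fun i _ => hi i
        _ = _ := by simp
    calc ‖(Δ (curl (W σ))) y‖ ≤ 3 * (‖curlCLM‖ * ‖iteratedFDeriv ℝ 3 (W σ) y‖) := hlap _ hv3 y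
      _ ≤ 3 * (‖curlCLM‖ * |K₃|) := by gcongr
      _ = 3 * ‖curlCLM‖ * |K₃| := by ring
  have hcv1 : ‖convect (W σ) (curl (W σ)) y‖ ≤ ‖curlCLM‖ * |K₂| * |K₀| := by
    show ‖fderiv ℝ (curl (W σ)) y (W σ y)‖ ≤ _
    calc ‖fderiv ℝ (curl (W σ)) y (W σ y)‖ ≤ ‖fderiv ℝ (curl (W σ)) y‖ * ‖W σ y‖ :=
          ContinuousLinearMap.le_opNorm _ _
      _ ≤ ‖curlCLM‖ * |K₂| * |K₀| := mul_le_mul hDω h0 (norm_nonneg _) (by positivity)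
  have hcv2 : ‖convect (curl (W σ)) (W σ) y‖ ≤ |K₁| * (‖curlCLM‖ * |K₁|) := by
    show ‖fderiv ℝ (W σ) y (curl (W σ) y)‖ ≤ _
    calc ‖fderiv ℝ (W σ) y (curl (W σ) y)‖ ≤ ‖fderiv ℝ (W σ) y‖ * ‖curl (W σ) y‖ :=
          ContinuousLinearMap.le_opNorm _ _
      _ ≤ |K₁| * (‖curlCLM‖ * |K₁|) := mul_le_mul h1 hω (norm_nonneg _) (abs_nonneg _)
  have hvd : ‖vdot W σ y‖ ≤ 3 * ‖curlCLM‖ * |K₃| + ‖curlCLM‖ * |K₂| * |K₀| + |K₁| * (‖curlCLM‖ * |K₁|) :=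
    (norm_sub_add_le _ _ _).trans (by linarith only [hΔ, hcv1, hcv2])
  have hK0 : 0 ≤ |K₀| := abs_nonneg _
  have hK1 : 0 ≤ ‖curlCLM‖ * |K₁| := by positivity
  have hK2 : 0 ≤ ‖curlCLM‖ * |K₂| := by positivity
  have hK3 : 0 ≤ 3 * ‖curlCLM‖ * |K₃| + ‖curlCLM‖ * |K₂| * |K₀| + |K₁| * (‖curlCLM‖ * |K₁|) := by positivity
  exact ⟨by linarith only [h0, hK1, hK2, hK3], by linarith only [hω, hK0, hK2, hK3],
    by linarith only [hDω, hK0, hK1, hK3], by linarith only [hvd, hK0, hK1, hK2]⟩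

/-! ## Continuity of the slice data -/

/-- Slices of a `𝒦_C` field are `C³`. -/
theorem contDiff_three_slice {C : ℝ} {W : ℝ → E3 → E3} (hW : IsTypeIAncientMild C W) {σ : ℝ} (hσ : σ < 0) :
    ContDiff ℝ (2 + 1) (W σ) := (hW.contDiff_slice hσ).of_le (by norm_cast)

/-- The vorticity of a slice of a `𝒦_C` field is `C²`. -/
theorem contDiff_two_curl_slice {C : ℝ} {W : ℝ → E3 → E3} (hW : IsTypeIAncientMild C W) {σ : ℝ} (hσ : σ < 0) :
    ContDiff ℝ 2 (curl (W σ)) := contDiff_curl (contDiff_three_slice hW hσ)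

/-- The vorticity time-derivative field `vdot` is continuous on a slice. -/
theorem continuous_vdot {C : ℝ} {W : ℝ → E3 → E3} (hW : IsTypeIAncientMild C W) {σ : ℝ} (hσ : σ < 0) :
    Continuous (vdot W σ) := by
  have hω2 := contDiff_two_curl_slice hW hσ
  have hv := hW.contDiff_slice hσ
  have h1 : Continuous (Δ (curl (W σ))) := continuous_laplacian hω2
  have h2 : Continuous fun y => fderiv ℝ (curl (W σ)) y (W σ y) :=
    (hω2.continuous_fderiv (by simp)).clm_apply hv.continuous
  have h3 : Continuous fun y => fderiv ℝ (W σ) y (curl (W σ) y) :=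
    (hv.continuous_fderiv (by simp)).clm_apply hω2.continuous
  exact (h1.sub h2).add h3

/-! ## The forward-shrinking cut-off `χ(σ, y) = ψ(‖y − y₀‖² / Rad(σ)²)`, `Rad(σ) = 1 + 2C√(−σ)` -/

/-- The radius scale `Rad(σ) = 1 + 2C√(−σ)`: it decreases toward `σ = 0` at (twice) the Type-I speed `C/√(−σ)`. -/
def Rad (C σ : ℝ) : ℝ := 1 + 2 * C * Real.sqrt (-σ)

/-- `1 ≤ Rad C σ`. -/
theorem one_le_Rad {C : ℝ} (hC : 0 ≤ C) (σ : ℝ) : 1 ≤ Rad C σ := by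
  have : 0 ≤ 2 * C * Real.sqrt (-σ) := by positivity
  unfold Rad; linarith

/-- `0 < Rad C σ`. -/
theorem Rad_pos {C : ℝ} (hC : 0 ≤ C) (σ : ℝ) : 0 < Rad C σ := lt_of_lt_of_le one_pos (one_le_Rad hC σ)

/-- `Rad C` is monotone backward in time. -/
theorem Rad_mono {C : ℝ} (hC : 0 ≤ C) {σ σ' : ℝ} (h : σ' ≤ σ) : Rad C σ ≤ Rad C σ' := by
  unfold Rad
  have := Real.sqrt_le_sqrt (neg_le_neg h)
  nlinarith

/-- The derivative of `Rad C`. -/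
theorem hasDerivAt_Rad (C : ℝ) {σ : ℝ} (hσ : σ < 0) : HasDerivAt (Rad C) (-(C / Real.sqrt (-σ))) σ := by
  have hs : 0 < Real.sqrt (-σ) := Real.sqrt_pos.2 (by linarith)
  have h1 : HasDerivAt (fun x : ℝ => Real.sqrt (-x)) ((-1) / (2 * Real.sqrt (-σ))) σ :=
    (hasDerivAt_neg σ).sqrt (by linarith)
  have h2 := (h1.const_mul (2 * C)).const_add 1
  have e : 2 * C * ((-1) / (2 * Real.sqrt (-σ))) = -(C / Real.sqrt (-σ)) := by
    field_simp
  rw [← e]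
  exact h2

/-- The cut-off dilation factor `a(σ) = Rad(σ)⁻²`. -/
def aW (C σ : ℝ) : ℝ := (Rad C σ ^ 2)⁻¹

/-- Its `σ`-derivative `a'(σ) = 2C / (√(−σ) Rad(σ)³) ≥ 0`. -/
def aW' (C σ : ℝ) : ℝ := 2 * C / (Real.sqrt (-σ) * Rad C σ ^ 3)

/-- `0 < aW C σ`. -/
theorem aW_pos {C : ℝ} (hC : 0 ≤ C) (σ : ℝ) : 0 < aW C σ := inv_pos.2 (pow_pos (Rad_pos hC σ) 2)

/-- `0 ≤ aW' C σ`. -/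
theorem aW'_nonneg {C : ℝ} (hC : 0 ≤ C) (σ : ℝ) : 0 ≤ aW' C σ :=
  div_nonneg (by positivity) (mul_nonneg (Real.sqrt_nonneg _) (pow_nonneg (Rad_pos hC σ).le 3))

/-- The derivative of `aW C`. -/
theorem hasDerivAt_aW {C : ℝ} (hC : 0 ≤ C) {σ : ℝ} (hσ : σ < 0) : HasDerivAt (aW C) (aW' C σ) σ := by
  have hR := Rad_pos hC σ
  have hs : 0 < Real.sqrt (-σ) := Real.sqrt_pos.2 (by linarith)
  have h1 := ((hasDerivAt_Rad C hσ).mul (hasDerivAt_Rad C hσ)).inv (mul_ne_zero hR.ne' hR.ne')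
  have hfun : aW C = (fun x => Rad C x * Rad C x)⁻¹ := funext fun x => by simp [aW, sq]
  rw [hfun]
  refine h1.congr_deriv ?_
  show _ = 2 * C / (Real.sqrt (-σ) * Rad C σ ^ 3)
  simp only [Pi.mul_apply]
  field_simp
  ring

/-- The cut-off `χ(σ, y) = ψ(a(σ) ‖y − y₀‖²)`. -/
def chi (C : ℝ) (y₀ : E3) (σ : ℝ) (y : E3) : ℝ := ψ (aW C σ * ‖y - y₀‖ ^ 2)

/-- `0 ≤ χ`. -/
theorem chi_nonneg (C : ℝ) (y₀ : E3) (σ : ℝ) (y : E3) : 0 ≤ chi C y₀ σ y := ψ_nonneg _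

/-- `χ ≤ 1`. -/
theorem chi_le_one (C : ℝ) (y₀ : E3) (σ : ℝ) (y : E3) : chi C y₀ σ y ≤ 1 := ψ_le_one _

/-- `χ(σ, y₀) = 1`. -/
theorem chi_self (C : ℝ) (y₀ : E3) (σ : ℝ) : chi C y₀ σ y₀ = 1 := by simp [chi, ψ_zero]

/-- Outside the ball of radius `√2·Rad`, the argument of `ψ` exceeds `2`. -/
theorem two_lt_aW_mul {C : ℝ} (hC : 0 ≤ C) {σ : ℝ} {y₀ y : E3} (h : Real.sqrt 2 * Rad C σ < ‖y - y₀‖) :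
    2 < aW C σ * ‖y - y₀‖ ^ 2 := by
  have hR := Rad_pos hC σ
  have h0 : 0 ≤ Real.sqrt 2 * Rad C σ := by positivity
  have h2 : (Real.sqrt 2 * Rad C σ) ^ 2 < ‖y - y₀‖ ^ 2 := by nlinarith
  rw [mul_pow, Real.sq_sqrt (by norm_num : (0:ℝ) ≤ 2)] at h2
  rw [aW, inv_mul_eq_div]
  exact (lt_div_iff₀ (pow_pos hR 2)).2 (by linarith)

/-- `χ = 0` outside the ball of radius `√2·Rad`. -/
theorem chi_eq_zero {C : ℝ} (hC : 0 ≤ C) {σ : ℝ} {y₀ y : E3} (h : Real.sqrt 2 * Rad C σ < ‖y - y₀‖) :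
    chi C y₀ σ y = 0 := ψ_of_two_le (two_lt_aW_mul hC h).le

/-- `ψ'` vanishes at the argument outside that ball. -/
theorem deriv_ψ_aW_eq_zero {C : ℝ} (hC : 0 ≤ C) {σ : ℝ} {y₀ y : E3} (h : Real.sqrt 2 * Rad C σ < ‖y - y₀‖) :
    deriv ψ (aW C σ * ‖y - y₀‖ ^ 2) = 0 := deriv_ψ_eq_zero_of_two_lt (two_lt_aW_mul hC h)

/-- `χ(σ, ·)` is smooth. -/
theorem contDiff_chi (C : ℝ) (y₀ : E3) (σ : ℝ) {n : ℕ∞} : ContDiff ℝ n (chi C y₀ σ) :=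
  ψ_contDiff.comp (contDiff_const.mul ((contDiff_id.sub contDiff_const).norm_sq ℝ))

/-- `χ(σ, ·)` is continuous. -/
theorem continuous_chi (C : ℝ) (y₀ : E3) (σ : ℝ) : Continuous (chi C y₀ σ) := (contDiff_chi C y₀ σ (n := 0)).continuous

/-- `χ(σ, ·)` has compact support. -/
theorem hasCompactSupport_chi {C : ℝ} (hC : 0 ≤ C) (y₀ : E3) (σ : ℝ) : HasCompactSupport (chi C y₀ σ) :=
  HasCompactSupport.intro (isCompact_closedBall y₀ (Real.sqrt 2 * Rad C σ)) fun y hy =>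
    chi_eq_zero hC (by rwa [mem_closedBall_iff_norm, not_le] at hy)

/-- The time derivative of `χ(·, y)`. -/
theorem hasDerivAt_chi {C : ℝ} (hC : 0 ≤ C) {σ : ℝ} (hσ : σ < 0) (y₀ y : E3) :
    HasDerivAt (fun s => chi C y₀ s y)
      (deriv ψ (aW C σ * ‖y - y₀‖ ^ 2) * (aW' C σ * ‖y - y₀‖ ^ 2)) σ :=
  (hasDerivAt_ψ _).comp σ ((hasDerivAt_aW hC hσ).mul_const _)

/-- The spatial derivative of `χ(σ, ·)`. -/
theorem fderiv_chi_apply (C : ℝ) (y₀ : E3) (σ : ℝ) (y w : E3) :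
    fderiv ℝ (chi C y₀ σ) y w = deriv ψ (aW C σ * ‖y - y₀‖ ^ 2) * (aW C σ * (2 * ⟪y - y₀, w⟫)) := by
  have h1 : HasFDerivAt (fun y : E3 => y - y₀) (ContinuousLinearMap.id ℝ E3) y := (hasFDerivAt_id y).sub_const y₀
  have h2 := (hasDerivAt_ψ _).comp_hasFDerivAt y ((h1.norm_sq).const_mul (aW C σ))
  rw [show chi C y₀ σ = ψ ∘ fun y => aW C σ * ‖y - y₀‖ ^ 2 from rfl, h2.fderiv]
  simp only [_root_.smul_apply, ContinuousLinearMap.comp_apply, ContinuousLinearMap.id_apply,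
    innerSL_apply_apply, smul_eq_mul, nsmul_eq_mul, Nat.cast_ofNat]

end Summit.NavierStokesRegularity.NavierStokesRegularity.Theorems.ScenarioCensus.IntegratedQuench

end
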